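import Literature.NumberTheory.Transcendental.AxSchanuelWeierstrass
import Literature.NumberTheory.Transcendental.AxSchanuelProofs
import Literature.NumberTheory.Transcendental.AxSchanuelWeierstrassProp4
import HarnessLib

/-!
# Ax–Schanuel for the Weierstrass `℘`-function: discharge of `ax_schanuel_weierstrass`

Topic `Literature/NumberTheory/Transcendental`. This file PROVES the named fact
`Literature.NumberTheory.Transcendental.ax_schanuel_weierstrass` (`AxSchanuelWeierstrass.lean`):
J. Kirby, *The theory of the exponential differential equations of semiabelian varieties*,
Selecta Math. 15 (2009), Thm. 3.8 (the Schanuel property) for `S = Eⁿ` in Weierstrass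
coordinates, in the (weaker, uniform) form vendored there.

**Proof** — Kirby's (Prop. 3.7, Step 1, and the rank–nullity count of the proof of Thm. 3.8,
pp. 17–18 of arXiv:0708.1352), run inside `Ω[K⁄C]` exactly as the tree's proof of Ax's theorem
(`AxSchanuelProofs.lean`), with Kirby's Steps 2–4 (Chevalley's theorem on subgroups generated by
subvarieties) replaced by the elliptic analogue of Rosenlicht's Prop. 4
(`AxSchanuelWeierstrassProp4.lean`):

1. (Kirby Lemmas 3.2–3.4) the forms `θᵢ = dXᵢ/Yᵢ - dxᵢ ∈ Ω[K⁄C]` — `ζ(yᵢ) - ξ(xᵢ)` for the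
   invariant differentials `ζ = dX/Y` of `E` and `ξ = dx` of `𝔾ₐ` — are killed by the Lie
   derivative of every `Dⱼ` (`lieDeriv_ellipticForm_eq_zero`: `ζ(yᵢ)` is closed because
   `dY = (6X² - g₂/2)/Y · dX`, and `Dⱼ*θᵢ = 0` is the exponential differential equation);
2. (Prop. 3.7, Step 1 = Rosenlicht's Wronskian lemma `exists_const_relation_lieDeriv`) a
   `K`-linear relation among the `θᵢ` yields one with constant coefficients `bᵢ ∈ C`, some
   `bᵢ = 1`: `Σ bᵢ dXᵢ/Yᵢ = d(Σ bᵢ xᵢ)`; by the elliptic Prop. 4 (`isAlgebraic_of_sum_invDiff`)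
   `Σ bᵢ xᵢ` is algebraic over `C`, hence a constant, contradicting the `C`-linear independence
   of `x̄` modulo `C` (`linearIndependent_ellipticForm`);
3. (proof of Thm. 3.8) with `V = span_K {dxᵢ, dXᵢ, dYᵢ} ⊆ Ω[K⁄C]` and `Φ = (Dⱼ*)ⱼ : V → Kᵐ`,
   the independent `θᵢ` lie in `ker Φ` and `Φ(dxᵢ) = (Dⱼ xᵢ)ⱼ`, so
   `n + rank (Dⱼ xᵢ) ≤ dim V ≤ trdeg_C C[x̄, X̄, Ȳ]` (`ax_schanuel_weierstrass_of_field`);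
4. the constants `C = ⋂ ker Dⱼ` get their field structure (`ax_schanuel_weierstrass_holds`).

## References

* J. Kirby, Selecta Math. (N.S.) 15 (2009), 445–486, §3.1–3.3 (Lemmas 3.1–3.4, Prop. 3.7,
  Thm. 3.8).
* J. Ax, Ann. of Math. 93 (1971), 252–268, Thm. 3; M. Rosenlicht, Pacific J. Math. 65 (1976),
  Props. 2–6 (the differential-forms machinery, `AxSchanuelLieDerivative.lean`).
-/

noncomputable section

open KaehlerDifferential

namespace Literature.NumberTheory.Transcendental

/-! ### Step 1: the forms `dXᵢ/Yᵢ - dxᵢ` are Lie-invariant -/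

section Field

variable {k K : Type} [Field k] [CharZero k] [Field K] [CharZero K] [Algebra k K] {m n : ℕ}

omit [CharZero k] in
/-- **Kirby 2009, Lemmas 3.2–3.4 for `E`** (cf. Rosenlicht 1976, Props. 2, 5): if
`Y² = 4X³ - g₂X - g₃` with `g₂, g₃ ∈ k`, `Y ≠ 0`, and `∂X = Y ∂x` (the exponential differential
equation of `E`), then the form `Y⁻¹ dX - dx ∈ Ω[K⁄k]` is killed by the Lie derivative of `∂`:
`D¹(Y⁻¹dX - dx) = -Y⁻²∂Y dX + Y⁻¹∂x dY = 0` since `2Y dY = (12X² - g₂) dX` and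
`2Y ∂Y = (12X² - g₂) Y ∂x`. [cite: Kirby2009, Lemma 3.3 and Prop. 3.7 (Step 1)] -/
theorem lieDeriv_ellipticForm_eq_zero (δ : Derivation k K K) {g₂ g₃ : k} {x X Y : K}
    (hE : Y ^ 2 = 4 * X ^ 3 - algebraMap k K g₂ * X - algebraMap k K g₃) (hY : Y ≠ 0)
    (hexp : δ X = Y * δ x) :
    Rosenlicht.lieDeriv δ (Y⁻¹ • D k K X - D k K x) = 0 := by
  have hE2 : Y * Y = 4 * (X * (X * X)) - algebraMap k K g₂ * X - algebraMap k K g₃ := by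
    linear_combination hE
  -- `2Y dY = (12X² - g₂) dX` in `Ω[K⁄k]`, and `2Y ∂Y = (12X² - g₂) Y ∂x` in `K`
  have h4 : D k K (4 : K) = 0 := by simpa using (D k K).map_natCast 4
  have hdY : (2 * Y) • D k K Y = (12 * X ^ 2 - algebraMap k K g₂) • D k K X := by
    have := congrArg (D k K) hE2
    simp only [map_sub, Derivation.leibniz, Derivation.map_algebraMap, h4, smul_zero, add_zero,
      sub_zero, smul_smul, ← add_smul] at this
    rw [← sub_smul] at this
    convert this using 2 <;> ring
  have hδ4 : δ (4 : K) = 0 := by simpa using δ.map_natCast 4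
  have hδY : 2 * Y * δ Y = (12 * X ^ 2 - algebraMap k K g₂) * (Y * δ x) := by
    have := congrArg δ hE2
    simp only [map_sub, Derivation.leibniz, Derivation.map_algebraMap, hδ4, sub_zero, smul_eq_mul,
      hexp] at this
    linear_combination this
  have h2Y : (2 * Y : K) ≠ 0 := mul_ne_zero two_ne_zero hY
  have hdY' : D k K Y = ((2 * Y)⁻¹ * (12 * X ^ 2 - algebraMap k K g₂)) • D k K X := by
    rw [mul_smul, ← hdY, smul_smul, inv_mul_cancel₀ h2Y, one_smul]
  -- `D¹(Y⁻¹dX - dx) = -Y⁻²∂Y dX + Y⁻¹∂x dY`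
  have key : Rosenlicht.lieDeriv δ (Y⁻¹ • D k K X - D k K x) =
      (-Y⁻¹ ^ 2 * δ Y) • D k K X + (Y⁻¹ * δ x) • D k K Y := by
    rw [map_sub, Rosenlicht.lieDeriv_smul_D, Rosenlicht.lieDeriv_D, hexp, Derivation.leibniz,
      δ.leibniz_inv]
    simp only [smul_add, smul_smul, smul_eq_mul, inv_mul_cancel₀ hY, one_smul]
    abel
  have hsc : -Y⁻¹ ^ 2 * δ Y + Y⁻¹ * δ x * ((2 * Y)⁻¹ * (12 * X ^ 2 - algebraMap k K g₂)) =
      Y⁻¹ ^ 2 * (2 * Y)⁻¹ * ((12 * X ^ 2 - algebraMap k K g₂) * (Y * δ x) - 2 * Y * δ Y) := by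
    field_simp
    ring
  rw [key, hdY', smul_smul, ← add_smul, hsc, ← hδY, sub_self, mul_zero, zero_smul]

/-! ### Step 2: the forms `dXᵢ/Yᵢ - dxᵢ` are `K`-linearly independent -/

/-- **Independence of the elliptic forms** (Kirby 2009, Prop. 3.7 for `S = Eⁿ`, with Steps 2–4
replaced by the elliptic Prop. 4). Let `k ⊆ K` be fields of characteristic zero and
`D₁, …, D_m` `k`-derivations of `K` whose common constants are exactly `k`; let `(Xᵢ, Yᵢ)` be
affine points of `Y² = 4X³ - g₂X - g₃` (`g₂, g₃ ∈ k`, `g₂³ - 27g₃² ≠ 0`) with `Yᵢ ≠ 0`,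
`Dⱼ Xᵢ = Yᵢ Dⱼ xᵢ`, and suppose no non-trivial `k`-combination `Σ aᵢ xᵢ` is a constant. Then the
forms `Yᵢ⁻¹ dXᵢ - dxᵢ ∈ Ω[K⁄k]` are linearly independent over `K`: by Step 1 and the Wronskian
lemma a relation could be taken with constant coefficients `bᵢ ∈ k` (some `bᵢ = 1`), i.e.
`Σ bᵢ Yᵢ⁻¹ dXᵢ = d(Σ bᵢ xᵢ)`, so `Σ bᵢ xᵢ` would be algebraic over `k`
(`isAlgebraic_of_sum_invDiff`), hence killed by the `Dⱼ` — absurd.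
[cite: Kirby2009, Prop. 3.7] -/
theorem linearIndependent_ellipticForm (Dv : Fin m → Derivation k K K)
    (hC : ∀ x : K, (∀ j, Dv j x = 0) → x ∈ Set.range (algebraMap k K))
    {g₂ g₃ : k} (hΔ : g₂ ^ 3 - 27 * g₃ ^ 2 ≠ 0) (x X Y : Fin n → K)
    (hE : ∀ i, Y i ^ 2 = 4 * X i ^ 3 - algebraMap k K g₂ * X i - algebraMap k K g₃)
    (hY : ∀ i, Y i ≠ 0) (hexp : ∀ j i, Dv j (X i) = Y i * Dv j (x i))
    (hind : ∀ a : Fin n → k, (∀ j, Dv j (∑ i, algebraMap k K (a i) * x i) = 0) → a = 0) :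
    LinearIndependent K fun i => (Y i)⁻¹ • D k K (X i) - D k K (x i) := by
  classical
  by_contra hdep
  obtain ⟨b, ⟨i₀, hi₀⟩, hbC, hrel⟩ := Rosenlicht.exists_const_relation_lieDeriv Dv _
    (fun j i => lieDeriv_ellipticForm_eq_zero (Dv j) (hE i) (hY i) (hexp j i)) hdep
  -- the coefficients come from `k`
  choose b' hb' using fun i => hC (b i) (fun j => hbC j i)
  have hb'₀ : b' i₀ = 1 := (algebraMap k K).injective (by rw [hb', hi₀, map_one])
  -- the relation, rewritten: `Σ bᵢ Yᵢ⁻¹ dXᵢ = dv` with `v = Σ bᵢ xᵢ`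
  set v : K := ∑ i, algebraMap k K (b' i) * x i with hv
  have hdv : D k K v = ∑ i, algebraMap k K (b' i) • D k K (x i) := by
    rw [hv, map_sum]
    refine Finset.sum_congr rfl fun i _ => ?_
    rw [Derivation.leibniz, Derivation.map_algebraMap, smul_zero, add_zero]
  have hrel' : ∑ i, algebraMap k K (b' i) • (Y i)⁻¹ • D k K (X i) = D k K v := by
    rw [hdv, ← sub_eq_zero, ← Finset.sum_sub_distrib, ← hrel]
    refine Finset.sum_congr rfl fun i _ => ?_
    rw [hb', smul_sub]
  -- dual form, and the elliptic Prop. 4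
  have H : ∀ δ : Derivation k K K,
      ∑ i, algebraMap k K (b' i) * ((Y i)⁻¹ * δ (X i)) = δ v := by
    intro δ
    have h := congrArg δ.liftKaehlerDifferential hrel'
    rw [map_sum, Derivation.liftKaehlerDifferential_comp_D] at h
    simpa only [map_smul, Derivation.liftKaehlerDifferential_comp_D, smul_eq_mul] using h
  have halg : IsAlgebraic k v := AxSchanuelWeierstrass.isAlgebraic_of_sum_invDiff hΔ b' X Y hE hY v H
  -- hence the `Dⱼ` kill `v`: contradiction
  have hb'0 : b' = 0 := hind b' fun j => Rosenlicht.derivation_eq_zero_of_isAlgebraic (Dv j) halg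
  rw [hb'0] at hb'₀
  exact zero_ne_one hb'₀

/-! ### Step 3: rank–nullity -/

/-- **Kirby 2009, Thm. 3.8 for `S = Eⁿ`, over a base field of constants**: for
`k`-derivations `D₁, …, D_m` of `K` with common constants exactly `k`, points `(Xᵢ, Yᵢ)` of
`Y² = 4X³ - g₂X - g₃` (`g₂³ - 27g₃² ≠ 0`, `Yᵢ ≠ 0`) with `Dⱼ Xᵢ = Yᵢ Dⱼ xᵢ` and `x̄`
`k`-linearly independent modulo constants, `n + rank (Dⱼ xᵢ)ᵢⱼ ≤ trdeg_k k[x̄, X̄, Ȳ]`. Proof: with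
`V = span_K {dxᵢ, dXᵢ, dYᵢ} ⊆ Ω[K⁄k]` and `Φ = (Dⱼ*)ⱼ : V → Kᵐ`, the independent forms
`Yᵢ⁻¹dXᵢ - dxᵢ` lie in `ker Φ` and the rows `(Dⱼ xᵢ)ⱼ = Φ(dxᵢ)` in `im Φ`, so
`n + rank ≤ dim V ≤ trdeg` (`finrank_span_le_trdeg_adjoin`).
[cite: Kirby2009, Thm. 3.8 (proof)] -/
theorem ax_schanuel_weierstrass_of_field (Dv : Fin m → Derivation k K K)
    (hC : ∀ x : K, (∀ j, Dv j x = 0) → x ∈ Set.range (algebraMap k K))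
    {g₂ g₃ : k} (hΔ : g₂ ^ 3 - 27 * g₃ ^ 2 ≠ 0) (x X Y : Fin n → K)
    (hE : ∀ i, Y i ^ 2 = 4 * X i ^ 3 - algebraMap k K g₂ * X i - algebraMap k K g₃)
    (hY : ∀ i, Y i ≠ 0) (hexp : ∀ j i, Dv j (X i) = Y i * Dv j (x i))
    (hind : ∀ a : Fin n → k, (∀ j, Dv j (∑ i, algebraMap k K (a i) * x i) = 0) → a = 0) :
    ((n + (Matrix.of fun i j => Dv j (x i)).rank : ℕ) : Cardinal) ≤
      Algebra.trdeg k (Algebra.adjoin k (Set.range x ∪ Set.range X ∪ Set.range Y)) := by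
  classical
  have hS : (Set.range x ∪ Set.range X ∪ Set.range Y).Finite :=
    ((Set.finite_range x).union (Set.finite_range X)).union (Set.finite_range Y)
  set V : Submodule K (Ω[K⁄k]) :=
    Submodule.span K (D k K '' (Set.range x ∪ Set.range X ∪ Set.range Y)) with hV
  have hxV : ∀ i, D k K (x i) ∈ V := fun i =>
    Submodule.subset_span ⟨x i, Or.inl (Or.inl ⟨i, rfl⟩), rfl⟩
  have hXV : ∀ i, D k K (X i) ∈ V := fun i =>
    Submodule.subset_span ⟨X i, Or.inl (Or.inr ⟨i, rfl⟩), rfl⟩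
  haveI : FiniteDimensional K V := FiniteDimensional.span_of_finite K (hS.image _)
  -- the forms `θᵢ` and the map `Φ`
  set θ : Fin n → Ω[K⁄k] := fun i => (Y i)⁻¹ • D k K (X i) - D k K (x i) with hθdef
  have hθV : ∀ i, θ i ∈ V := fun i => V.sub_mem (V.smul_mem _ (hXV i)) (hxV i)
  have hθ : LinearIndependent K θ := linearIndependent_ellipticForm Dv hC hΔ x X Y hE hY hexp hind
  set Φ : Ω[K⁄k] →ₗ[K] (Fin m → K) := LinearMap.pi fun j => (Dv j).liftKaehlerDifferential
    with hΦdef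
  have hΦD : ∀ y : K, Φ (D k K y) = fun j => Dv j y := fun y => by
    ext j
    simp [hΦdef, Derivation.liftKaehlerDifferential_comp_D]
  have hΦθ : ∀ i, Φ (θ i) = 0 := fun i => by
    ext j
    rw [hθdef, map_sub, map_smul, hΦD, hΦD]
    simp only [Pi.sub_apply, Pi.smul_apply, smul_eq_mul, Pi.zero_apply, hexp j i]
    rw [← mul_assoc, inv_mul_cancel₀ (hY i), one_mul, sub_self]
  set f : V →ₗ[K] (Fin m → K) := Φ.comp V.subtype with hf
  have hrn := LinearMap.finrank_range_add_finrank_ker f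
  -- `n ≤ dim ker`
  have h1 : n ≤ Module.finrank K (LinearMap.ker f) := by
    set θ' : Fin n → V := fun i => ⟨θ i, hθV i⟩ with hθ'
    have hθ'ind : LinearIndependent K θ' := LinearIndependent.of_comp V.subtype (by exact hθ)
    have hle : Submodule.span K (Set.range θ') ≤ LinearMap.ker f := by
      rw [Submodule.span_le]
      rintro _ ⟨i, rfl⟩
      simp only [SetLike.mem_coe, LinearMap.mem_ker, hf, LinearMap.comp_apply,
        Submodule.subtype_apply, hθ']
      exact hΦθ i
    calc n = Fintype.card (Fin n) := (Fintype.card_fin n).symm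
      _ = Module.finrank K (Submodule.span K (Set.range θ')) := (finrank_span_eq_card hθ'ind).symm
      _ ≤ Module.finrank K (LinearMap.ker f) := Submodule.finrank_mono hle
  -- `rank ≤ dim im`
  have h2 : (Matrix.of fun i j => Dv j (x i)).rank ≤ Module.finrank K (LinearMap.range f) := by
    rw [Matrix.rank_eq_finrank_span_row]
    apply Submodule.finrank_mono
    rw [Submodule.span_le]
    rintro _ ⟨i, rfl⟩
    refine ⟨⟨D k K (x i), hxV i⟩, ?_⟩
    rw [hf, LinearMap.comp_apply, Submodule.subtype_apply, hΦD]
    rfl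
  -- `dim V ≤ trdeg`
  have h3 := Rosenlicht.finrank_span_le_trdeg_adjoin (D k K)
    (Set.range x ∪ Set.range X ∪ Set.range Y) hS
  calc ((n + (Matrix.of fun i j => Dv j (x i)).rank : ℕ) : Cardinal)
      ≤ (Module.finrank K V : Cardinal) := by exact_mod_cast (by omega)
    _ ≤ _ := h3

end Field

/-! ### Step 4: the named fact -/

/-- **Ax–Schanuel for the Weierstrass `℘`-function HOLDS** (the named fact
`ax_schanuel_weierstrass` of `AxSchanuelWeierstrass.lean`: Kirby 2009, Thm. 3.8 for `S = Eⁿ` in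
Weierstrass coordinates, uniform form): give the constants `C = ⋂ ker Dⱼ` their field structure,
view the `Dⱼ` as `C`-derivations and `g₂, g₃` as elements of `C`, and apply
`ax_schanuel_weierstrass_of_field`. [cite: Kirby2009, Thm. 3.8] -/
theorem ax_schanuel_weierstrass_holds : ax_schanuel_weierstrass := by
  intro K _ _ m n Dv g₂ g₃ x X Y hg₂ hg₃ hΔ hE hY hexp hind
  classical
  letI : Field (constantSubring Dv) := (isField_constantSubring Dv).toField
  haveI : CharZero (constantSubring Dv) := (algebraMap (constantSubring Dv) K).charZero
  have hC : ∀ y : K, (∀ j, toConstDerivation Dv j y = 0) →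
      y ∈ Set.range (algebraMap (constantSubring Dv) K) :=
    fun y hy => ⟨⟨y, fun j => hy j⟩, rfl⟩
  set g₂' : constantSubring Dv := ⟨g₂, hg₂⟩ with hg₂'
  set g₃' : constantSubring Dv := ⟨g₃, hg₃⟩ with hg₃'
  have hΔ' : g₂' ^ 3 - 27 * g₃' ^ 2 ≠ 0 := by
    intro h
    apply hΔ
    have := congrArg (algebraMap (constantSubring Dv) K) h
    rw [map_sub, map_mul, map_pow, map_pow, map_ofNat, map_zero] at this
    exact this
  have hE' : ∀ i, Y i ^ 2 = 4 * X i ^ 3 - algebraMap (constantSubring Dv) K g₂' * X i -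
      algebraMap (constantSubring Dv) K g₃' := hE
  have hind' : ∀ a : Fin n → constantSubring Dv,
      (∀ j, toConstDerivation Dv j (∑ i, algebraMap (constantSubring Dv) K (a i) * x i) = 0) →
        a = 0 := by
    intro a ha
    have h := hind (fun i => (a i : K)) (fun i => (a i).2) (fun j => ha j)
    funext i
    exact Subtype.ext (congrFun h i)
  exact ax_schanuel_weierstrass_of_field (toConstDerivation Dv) hC hΔ' x X Y hE' hY
    (fun j i => hexp j i) hind'

end Literature.NumberTheory.Transcendental
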